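import Summits.CriticalPhenomena.PercolationContinuityZ3.Theorems.PercNearOneGluingNoHeavyLowerTailSectorTransfer
import HarnessLib

/-!
# `NoHeavyLowerTail` (stmt-CriticalPhenomena-4575) — three relays: the registered SECTOR stubs (I), (II) close the rung (gen 5, `nh-dp-commonrelay`)

Support file (`--supports stmt-CriticalPhenomena-4575`); no definitions, no named facts, no sorries.  The statements of the two hypothesis-carrying
stubs registered on stmt-4575 — `stub_sectorClaimIpsi` (sector piece (I) = CLAIM-I-ψ) and `stub_sectorII` (sector piece (II); its instance at
`(a₂, a₁)` is (III)) — taken VERBATIM as hypotheses `hI`, `hII`, give the pre-FKG inequality (3) at the designated relay `a₃` for every three-relay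
configuration with `μ(all three relays separated) > 0` and `τ₃ ≤ τ₁, τ₂` (Kozma–Nitzan Question 7 at `|A| = 3`, the first open rung of `stub_dcone`),
via `preFKG3_of_sectorTransfer` (file `…SectorTransfer`).  (Supersedes `…SectorTransferStubs`, whose hypothesis `Σ₁` is refuted in `…SectorSigmaCex`.)
[cite: KozmaNitzan2024, Question 7 (§5.5, p. 36), Theorem 2 (pp. 8–9)]
-/

namespace Summit.CriticalPhenomena.PercolationContinuityZ3.Theorems

open MeasureTheory Set Literature.Probability.LatticeModels Literature.Probability.Percolation

noncomputable section
open Classical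

/-- **KN Question 7 at three relays from the two registered SECTOR stubs (I), (II).**  If the sector inequalities (I)
(`stub_sectorClaimIpsi`) and (II) (`stub_sectorII`, applied at `(a₁,a₂)` and at `(a₂,a₁)`) hold for all finite weighted graphs, then for all
pairwise distinct `o, b, a₁, a₂, a₃` with `τ₃ ≤ τ₁`, `τ₃ ≤ τ₂` and `μ(a₁, a₂, a₃ pairwise separated) > 0`:  `μ(o↔A, a₃↔b) ≤ μ(o↔A, o↔b)`.
[this file; cite: KozmaNitzan2024, Question 7 (p. 36)] -/
theorem preFKG3_of_sectorStubs
    (hI : ∀ (n : ℕ) (w : Sym2 (Fin n) → unitInterval) (o b a₁ a₂ a₃ : Fin n), a₁ ≠ a₂ → a₁ ≠ a₃ → a₂ ≠ a₃ → o ≠ a₁ → o ≠ a₂ → o ≠ a₃ → b ≠ a₁ → b ≠ a₂ → b ≠ a₃ → o ≠ b → (prodBernoulli w).real (openConn a₃ b) ≤ (prodBernoulli w).real (openConn a₁ b) → (prodBernoulli w).real (openConn a₃ b) ≤ (prodBernoulli w).real (openConn a₂ b) → ((prodBernoulli w).real ((openConn a₁ a₂)ᶜ ∩ (openConn a₁ a₃)ᶜ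 ∩ (openConn a₂ a₃)ᶜ ∩ openConn a₁ o) + (prodBernoulli w).real ((openConn a₁ a₂)ᶜ ∩ (openConn a₁ a₃)ᶜ ∩ (openConn a₂ a₃)ᶜ ∩ openConn a₂ o)) * ((prodBernoulli w).real ((openConn a₁ a₃)ᶜ ∩ (openConn a₂ a₃)ᶜ ∩ (openConn a₁ b ∩ openConn a₂ b)) - (prodBernoulli w).real ((openConn a₁ a₃)ᶜ ∩ (openConn a₂ a₃)ᶜ ∩ openConn a₃ b)) ≤ (prodBernoulli w).real ((openConn a₁ a₂)ᶜ ∩ (openConn a₁ a₃)ᶜ ∩ (openConn a₂ a₃)ᶜ : Set (BondConfig (Fin n))) * ((prodBernoulli w).real ((openConn a₁ a₃)ᶜ ∩ (openConn a₂ a₃)ᶜ ∩ ((openConn a₁ o ∪ openConn a₂ o) ∩ (openConn a₁ b ∩ openConn a₂ b))) - (prodBernoulli w).real ((openConn a₁ a₃)ᶜ ∩ (openConn a₂ a₃)ᶜ ∩ ((openConn a₁ o ∪ openConn a₂ o) ∩ openConn a₃ b))))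
    (hII : ∀ (n : ℕ) (w : Sym2 (Fin n) → unitInterval) (o b a₁ a₂ a₃ : Fin n), a₁ ≠ a₂ → a₁ ≠ a₃ → a₂ ≠ a₃ → o ≠ a₁ → o ≠ a₂ → o ≠ a₃ → b ≠ a₁ → b ≠ a₂ → b ≠ a₃ → o ≠ b → (prodBernoulli w).real (openConn a₃ b) ≤ (prodBernoulli w).real (openConn a₁ b) → (prodBernoulli w).real (openConn a₃ b) ≤ (prodBernoulli w).real (openConn a₂ b) → (prodBernoulli w).real ((openConn a₁ a₂)ᶜ ∩ (openConn a₁ a₃)ᶜ ∩ (openConn a₂ a₃)ᶜ : Set (BondConfig (Fin n))) * (prodBernoulli w).real ((openConn a₁ a₂)ᶜ ∩ (openConn a₁ a₃)ᶜ ∩ openConn a₁ o) * ((prodBernoulli w).real (openConn a₁ b) - (prodBernoulli w).real (openConn a₃ b)) + (prodBernoulli w).real ((openConn a₁ a₂)ᶜ ∩ (openConn a₁ a₃)ᶜ : Set (BondConfig (Fin n))) * (prodBernoulli w).real ((openConn a₁ a₂)ᶜ ∩ (openConn a₁ a₃)ᶜ ∩ (openConn a₂ a₃)ᶜ ∩ openConn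 a₁ o) * ((prodBernoulli w).real ((openConn a₁ a₃)ᶜ ∩ (openConn a₂ a₃)ᶜ ∩ openConn a₃ b) - (prodBernoulli w).real ((openConn a₁ a₃)ᶜ ∩ (openConn a₂ a₃)ᶜ ∩ (openConn a₁ b ∩ openConn a₂ b))) ≤ (prodBernoulli w).real ((openConn a₁ a₂)ᶜ ∩ (openConn a₁ a₃)ᶜ : Set (BondConfig (Fin n))) * (prodBernoulli w).real ((openConn a₁ a₂)ᶜ ∩ (openConn a₁ a₃)ᶜ ∩ (openConn a₂ a₃)ᶜ : Set (BondConfig (Fin n))) * ((prodBernoulli w).real ((openConn a₁ a₂)ᶜ ∩ (openConn a₁ a₃)ᶜ ∩ (openConn a₁ o ∩ openConn a₁ b)) - (prodBernoulli w).real ((openConn a₁ a₂)ᶜ ∩ (openConn a₁ a₃)ᶜ ∩ (openConn a₁ o ∩ (openConn a₂ b ∩ openConn a₃ b)))))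
    {n : ℕ} (w : Sym2 (Fin n) → unitInterval) (o b a₁ a₂ a₃ : Fin n)
    (h12 : a₁ ≠ a₂) (h13 : a₁ ≠ a₃) (h23 : a₂ ≠ a₃) (ho1 : o ≠ a₁) (ho2 : o ≠ a₂) (ho3 : o ≠ a₃)
    (hb1 : b ≠ a₁) (hb2 : b ≠ a₂) (hb3 : b ≠ a₃) (hob : o ≠ b)
    (hM : 0 < (prodBernoulli w).real ((openConn a₁ a₂)ᶜ ∩ (openConn a₁ a₃)ᶜ ∩ (openConn a₂ a₃)ᶜ : Set (BondConfig (Fin n))))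
    (hτ₁ : (prodBernoulli w).real (openConn a₃ b) ≤ (prodBernoulli w).real (openConn a₁ b))
    (hτ₂ : (prodBernoulli w).real (openConn a₃ b) ≤ (prodBernoulli w).real (openConn a₂ b)) :
    (prodBernoulli w).real ((openConn o a₁ ∪ openConn o a₂ ∪ openConn o a₃) ∩ openConn a₃ b) ≤
      (prodBernoulli w).real ((openConn o a₁ ∪ openConn o a₂ ∪ openConn o a₃) ∩ openConn o b) := by
  have h2 := hII n w o b a₁ a₂ a₃ h12 h13 h23 ho1 ho2 ho3 hb1 hb2 hb3 hob hτ₁ hτ₂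
  have h3 := hII n w o b a₂ a₁ a₃ h12.symm h23 h13 ho2 ho1 ho3 hb2 hb1 hb3 hob hτ₂ hτ₁
  have eM : ((openConn a₂ a₁)ᶜ ∩ (openConn a₂ a₃)ᶜ ∩ (openConn a₁ a₃)ᶜ : Set (BondConfig (Fin n))) =
      (openConn a₁ a₂)ᶜ ∩ (openConn a₁ a₃)ᶜ ∩ (openConn a₂ a₃)ᶜ := by
    ext ω
    simp only [Set.mem_inter_iff, Set.mem_compl_iff, knThm2_mem_openConn]
    constructor
    · rintro ⟨⟨h21, h23'⟩, h13'⟩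
      exact ⟨⟨fun h => h21 h.symm, h13'⟩, h23'⟩
    · rintro ⟨⟨h12', h13'⟩, h23'⟩
      exact ⟨⟨fun h => h12' h.symm, h23'⟩, h13'⟩
  have eN : ((openConn a₂ a₃)ᶜ ∩ (openConn a₁ a₃)ᶜ : Set (BondConfig (Fin n))) = (openConn a₁ a₃)ᶜ ∩ (openConn a₂ a₃)ᶜ :=
    Set.inter_comm _ _
  have eB : (openConn a₂ b ∩ openConn a₁ b : Set (BondConfig (Fin n))) = openConn a₁ b ∩ openConn a₂ b :=
    Set.inter_comm _ _
  rw [eM, eN, eB] at h3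
  exact preFKG3_of_sectorTransfer w o b a₁ a₂ a₃ hM hτ₁ hτ₂
    (hI n w o b a₁ a₂ a₃ h12 h13 h23 ho1 ho2 ho3 hb1 hb2 hb3 hob hτ₁ hτ₂) h2 h3

end

end Summit.CriticalPhenomena.PercolationContinuityZ3.Theorems
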